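import Summits.HubbardSuperconductivity.HubbardSuperconductivity.Theses.NodalWardXY

/-!
# `PerturbedXYOrder` (crux stmt-HubbardSuperconductivity-10739, route `NodalWardXY`): vocabulary

Named pieces of the crux `Summit.HubbardSuperconductivity.HubbardSuperconductivity.Theses.NodalWardXY.PerturbedXYOrder`
(classical XY model on `(ℤ/Lℤ)³` perturbed by a complex two-current kernel), so that the stubs of the
line `schwarz-inheritance` (`Cruxes/PerturbedXYOrder/Lines/schwarz-inheritance.lean`) and the closing
theorem can be stated and landed one by one as `--supports` helpers.  Every definition below is
LITERALLY a `let` of the crux (same binder names as the standing disprover's work file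
`Cruxes/PerturbedXYOrder/Disproof.lean` §0, which Theorems files cannot import), and
`perturbedXYOrder_iff` records by `Iff.rfl` that the crux is the statement over this vocabulary:

* `Bond L`        — directed bonds `(x, i)` of the torus, `TorusSite 3 L × Fin 3`;
* `cube L`        — the configuration cube `[0, 2π]^Λ`;
* `cur b θ`       — the bond current `j_{(x,i)}(θ) = sin(θ_{x+e_i} − θ_x)`;
* `wJ J θ`        — the ferromagnetic weight `exp(J Σ_b cos ∇_b θ)` as a complex number;
* `Wk K θ`        — the perturbation `W_K(θ) = Σ_{b,b'} K(b,b') j_b j_{b'}`;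
* `Zk J K`        — the perturbed partition function `∫_cube w_J e^{W_K}`;
* `num J K`       — the magnetisation numerator `Σ_{x,y} ∫_cube cos(θ_x − θ_y) w_J e^{W_K}`;
* `cratio L J K`  — the COMPLEX plateau `num / Z_K / L⁶` (the crux bounds its real part);
* `Admissible L ε K` — `‖K(b,b')‖ ≤ ε (1 + dist(x,x'))⁻⁴`.

No mathematics is asserted here (definitions + one `Iff.rfl`).
-/

noncomputable section

namespace Summit.HubbardSuperconductivity.HubbardSuperconductivity.Theorems.PerturbedXYOrder

open MeasureTheory Literature.Probability.LatticeModels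
open Summit.HubbardSuperconductivity.HubbardSuperconductivity.Theses.NodalWardXY

/-- Directed bonds `b = (x, i)` of the torus `(ℤ/Lℤ)³`, from `x` to `x + e_i` (the crux's bond type
`TorusSite 3 L × Fin 3`). -/
abbrev Bond (L : ℕ) : Type := TorusSite 3 L × Fin 3

/-- The configuration cube `[0, 2π]^Λ` of angle fields (the crux's `cube`). -/
def cube (L : ℕ) : Set (TorusSite 3 L → ℝ) := Set.pi Set.univ (fun _ => Set.Icc (0:ℝ) (2 * Real.pi))

/-- The bond current `j_b(θ) = sin(θ_{x+e_i} − θ_x)` (the crux's `cur`). -/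
def cur {L : ℕ} (b : Bond L) (θ : TorusSite 3 L → ℝ) : ℝ := Real.sin (θ (b.1 + Pi.single b.2 1) - θ b.1)

/-- The ferromagnetic XY weight `w_J(θ) = exp(J Σ_b cos ∇_b θ)`, as a complex number (the crux's `wJ`). -/
def wJ {L : ℕ} [NeZero L] (J : ℝ) (θ : TorusSite 3 L → ℝ) : ℂ :=
  ((Real.exp (J * ∑ b : Bond L, Real.cos (θ (b.1 + Pi.single b.2 1) - θ b.1)) : ℝ) : ℂ)

/-- The complex two-current perturbation `W_K(θ) = Σ_{b,b'} K(b,b') j_b(θ) j_{b'}(θ)` (the crux's `W`). -/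
def Wk {L : ℕ} [NeZero L] (K : Bond L → Bond L → ℂ) (θ : TorusSite 3 L → ℝ) : ℂ :=
  ∑ b, ∑ b', K b b' * (cur b θ : ℂ) * (cur b' θ : ℂ)

/-- The perturbed partition function `Z_K = ∫_cube w_J e^{W_K} dθ` (the crux's `Z`). -/
def Zk {L : ℕ} [NeZero L] (J : ℝ) (K : Bond L → Bond L → ℂ) : ℂ :=
  MeasureTheory.integral (MeasureTheory.volume.restrict (cube L)) (fun θ => wJ J θ * Complex.exp (Wk K θ))

/-- The un-normalised magnetisation numerator `Σ_{x,y} ∫_cube cos(θ_x − θ_y) w_J e^{W_K} dθ`. -/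
def num {L : ℕ} [NeZero L] (J : ℝ) (K : Bond L → Bond L → ℂ) : ℂ :=
  ∑ x : TorusSite 3 L, ∑ y : TorusSite 3 L, MeasureTheory.integral (MeasureTheory.volume.restrict (cube L))
    (fun θ => (Real.cos (θ x - θ y) : ℂ) * (wJ J θ * Complex.exp (Wk K θ)))

/-- The complex plateau `num / Z_K / L⁶`; the crux asserts `a ≤ Re (cratio L J K)`. -/
def cratio (L : ℕ) [NeZero L] (J : ℝ) (K : Bond L → Bond L → ℂ) : ℂ :=
  num J K / Zk J K / ((L : ℂ) ^ 6)

/-- Admissible kernels at radius `ε`: `‖K(b,b')‖ ≤ ε (1 + dist(x,x'))⁻⁴` in the graph distance of the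
torus (the crux's hypothesis on `K`). -/
def Admissible (L : ℕ) [NeZero L] (ε : ℝ) (K : Bond L → Bond L → ℂ) : Prop :=
  ∀ b b', ‖K b b'‖ ≤ ε / (1 + ((torusGraph 3 L).dist b.1 b'.1 : ℝ)) ^ 4

/-- The crux `PerturbedXYOrder` is, definitionally, the statement over this vocabulary. -/
theorem perturbedXYOrder_iff :
    PerturbedXYOrder ↔
      ∃ J₀ ε a : ℝ, 0 < ε ∧ 0 < a ∧ ∀ J : ℝ, J₀ ≤ J → ∀ (L : ℕ) [NeZero L], 2 ≤ L →
        ∀ K : Bond L → Bond L → ℂ, Admissible L ε K → Zk J K ≠ 0 ∧ a ≤ (cratio L J K).re :=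
  Iff.rfl

end Summit.HubbardSuperconductivity.HubbardSuperconductivity.Theorems.PerturbedXYOrder

end
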